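import Mathlib

/-!
# Intertwined orthogonal matrices: `(tr P − tr R)² ≤ (corank)²` (kernel tool for the partial-Hadamard rank test)

Framing: lottery ticket; floor = certified bounds/negative ranges.  Cell pub-namedobj (venture DiscreteObjects),
target (H) = `H(668)`, hadamard gen 31.  ABSTRACT LINEAR ALGEBRA over `ℚ` (Mathlib only), prepared for the 'partial-Hadamard rank
test' of the srg(333,166,82,83) census (pub-namedobj-hadamard-g31/PAPER-SECTION-H-involutions-g31.md §6): if `B` (`m × n`) has a right
Gram inverse `K` (`B Bᵀ K = 1`, `Kᵀ = K`), and orthogonal `R` (`m × m`), `P` (`n × n`) intertwine, `B P = R B`, with `R K = K R`, then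
`M = Bᵀ K B` is the orthogonal projection onto the row space of `B`, it commutes with `P`, `tr M = |m|`, `tr(P M) = tr R`, and the
Frobenius Cauchy–Schwarz inequality on `Q = 1 − M` gives
* `trace_orthogonal_mul_proj_sq_le` — `(tr (P Q))² ≤ (tr Q)²` for a symmetric idempotent `Q` commuting with an orthogonal `P`;
* **`trace_sub_sq_le_of_intertwining`** — `(tr P − tr R)² ≤ (|n| − |m|)²`.
Intended instance (not formalised here): `B` = fixed-vertex / `⟨ρ⟩`-orbit incidence of an automorphism `ρ` of order `11` (`25 × 28`,
`B Bᵀ = 7(I + J)`, `K = (I − J/26)/7`), `R`, `P` = the actions of an element commuting with `ρ` on the fixed set and on the orbits: then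
`#(orbits fixed) − #(fixed points in F) ∈ [−3, 3]`, which with the census kit leaves 7 of 16 cycle types for order `22` (E2:
code/rank_test_11_g31.py).  WORDS: a general lemma (elementary); ours.  No `sorry`, no new definitions.
-/

namespace Summit.Ventures.DiscreteObjects.Hadamard

open Matrix

section intertwined
variable {m n : Type*} [Fintype m] [Fintype n] [DecidableEq m] [DecidableEq n]

/-- **Frobenius Cauchy–Schwarz for traces.**  For a symmetric idempotent `Q` commuting with an orthogonal `P` (rational matrices):
`(tr (P Q))² ≤ (tr Q)²`. -/
theorem trace_orthogonal_mul_proj_sq_le (P Q : Matrix n n ℚ) (hQ2 : Q * Q = Q) (hQt : Qᵀ = Q)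
    (hP : Pᵀ * P = 1) (hc : P * Q = Q * P) : (trace (P * Q)) ^ 2 ≤ (trace Q) ^ 2 := by
  set Y := P * Q with hY
  have hQs : ∀ i j, Q j i = Q i j := fun i j => by
    have := congrFun (congrFun hQt i) j
    rwa [Matrix.transpose_apply] at this
  -- Y = Q * Y
  have hYQ : Y = Q * Y := by
    rw [hY, ← Matrix.mul_assoc, ← hc, Matrix.mul_assoc, hQ2]
  -- trace Y as a double sum
  have h1 : trace Y = ∑ i, ∑ j, Q i j * Y j i := by
    conv_lhs => rw [hYQ]
    simp only [Matrix.trace, Matrix.diag_apply, Matrix.mul_apply]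
  -- Σ Q_ij² = trace Q
  have h2 : ∑ i, ∑ j, Q i j ^ 2 = trace Q := by
    conv_rhs => rw [← hQ2]
    simp only [Matrix.trace, Matrix.diag_apply, Matrix.mul_apply]
    refine Finset.sum_congr rfl fun i _ => Finset.sum_congr rfl fun j _ => ?_
    rw [sq, hQs j i]
  -- Σ Y_ji² = trace (Yᵀ Y) = trace Q
  have hYY : Yᵀ * Y = Q := by
    rw [hY, Matrix.transpose_mul, Matrix.mul_assoc, ← Matrix.mul_assoc Pᵀ, hP, Matrix.one_mul, hQt, hQ2]
  have h3 : ∑ i, ∑ j, Y j i ^ 2 = trace Q := by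
    rw [← hYY]
    simp only [Matrix.trace, Matrix.diag_apply, Matrix.mul_apply, Matrix.transpose_apply]
    exact Finset.sum_congr rfl fun i _ => Finset.sum_congr rfl fun j _ => by rw [sq]
  -- Cauchy–Schwarz on univ ×ˢ univ
  have hcs := Finset.sum_mul_sq_le_sq_mul_sq ((Finset.univ : Finset n) ×ˢ (Finset.univ : Finset n))
    (fun p => Q p.1 p.2) (fun p => Y p.2 p.1)
  rw [Finset.sum_product, Finset.sum_product, Finset.sum_product] at hcs
  simp only at hcs
  rw [← h1, h2, h3] at hcs
  rw [hY] at hcs ⊢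
  calc (trace (P * Q)) ^ 2 ≤ trace Q * trace Q := hcs
    _ = (trace Q) ^ 2 := by ring

/-- **Intertwined orthogonal matrices have nearly equal traces.**  If `B Bᵀ K = 1` (`Kᵀ = K`), `R`, `P` orthogonal with `B P = R B`
and `R K = K R`, then `(tr P − tr R)² ≤ (|n| − |m|)²`. -/
theorem trace_sub_sq_le_of_intertwining (B : Matrix m n ℚ) (K : Matrix m m ℚ) (hBK : B * Bᵀ * K = 1) (hKt : Kᵀ = K)
    (R : Matrix m m ℚ) (P : Matrix n n ℚ) (hR : Rᵀ * R = 1) (hP : Pᵀ * P = 1) (hRK : R * K = K * R)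
    (hBP : B * P = R * B) :
    (trace P - trace R) ^ 2 ≤ ((Fintype.card n : ℚ) - Fintype.card m) ^ 2 := by
  -- K is a two-sided inverse of B Bᵀ
  have hKB : K * (B * Bᵀ) = 1 := mul_eq_one_comm.mp hBK
  have hP' : P * Pᵀ = 1 := mul_eq_one_comm.mp hP
  set M := Bᵀ * K * B with hM
  -- M is a symmetric idempotent
  have hM2 : M * M = M := by
    have e : B * (Bᵀ * (K * B)) = B := by
      rw [← Matrix.mul_assoc, ← Matrix.mul_assoc, hBK, Matrix.one_mul]
    calc M * M = Bᵀ * (K * (B * (Bᵀ * (K * B)))) := by simp only [hM, Matrix.mul_assoc]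
      _ = Bᵀ * (K * B) := by rw [e]
      _ = M := by rw [hM, Matrix.mul_assoc]
  have hMt : Mᵀ = M := by
    rw [hM, Matrix.transpose_mul, Matrix.transpose_mul, Matrix.transpose_transpose, hKt, Matrix.mul_assoc]
  -- P Bᵀ = Bᵀ R
  have hPB : P * Bᵀ = Bᵀ * R := by
    have e1 : Pᵀ * Bᵀ = Bᵀ * Rᵀ := by rw [← Matrix.transpose_mul, ← Matrix.transpose_mul, hBP]
    have e2 : Bᵀ = P * (Bᵀ * Rᵀ) := by rw [← e1, ← Matrix.mul_assoc, hP', Matrix.one_mul]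
    calc P * Bᵀ = P * (Bᵀ * Rᵀ) * R := by
          rw [Matrix.mul_assoc, Matrix.mul_assoc, hR, Matrix.mul_one]
      _ = Bᵀ * R := by rw [← e2]
  -- M commutes with P
  have hPM : P * M = M * P := by
    calc P * M = P * Bᵀ * (K * B) := by rw [hM, Matrix.mul_assoc, ← Matrix.mul_assoc P]
      _ = Bᵀ * (R * K) * B := by rw [hPB, Matrix.mul_assoc, Matrix.mul_assoc, Matrix.mul_assoc]
      _ = Bᵀ * (K * R) * B := by rw [hRK]
      _ = Bᵀ * K * (R * B) := by rw [Matrix.mul_assoc, Matrix.mul_assoc, Matrix.mul_assoc]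
      _ = Bᵀ * K * (B * P) := by rw [hBP]
      _ = M * P := by simp only [hM, Matrix.mul_assoc]
  -- traces
  have htrM : trace M = Fintype.card m := by
    rw [hM, Matrix.mul_assoc, Matrix.trace_mul_comm, Matrix.mul_assoc, hKB, Matrix.trace_one]
  have htrPM : trace (P * M) = trace R := by
    calc trace (P * M) = trace (P * Bᵀ * (K * B)) := by rw [hM, Matrix.mul_assoc, ← Matrix.mul_assoc P]
      _ = trace (Bᵀ * (R * (K * B))) := by rw [hPB, Matrix.mul_assoc]
      _ = trace (R * (K * B) * Bᵀ) := by rw [Matrix.trace_mul_comm, Matrix.mul_assoc]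
      _ = trace (R * (K * (B * Bᵀ))) := by rw [Matrix.mul_assoc, Matrix.mul_assoc]
      _ = trace R := by rw [hKB, Matrix.mul_one]
  -- Q = 1 − M
  have hQ2 : (1 - M) * (1 - M) = 1 - M := by
    rw [Matrix.sub_mul, Matrix.mul_sub, Matrix.mul_sub, Matrix.one_mul, Matrix.mul_one, Matrix.one_mul, hM2]; abel
  have hQt : (1 - M)ᵀ = 1 - M := by rw [Matrix.transpose_sub, Matrix.transpose_one, hMt]
  have hcQ : P * (1 - M) = (1 - M) * P := by rw [Matrix.mul_sub, Matrix.sub_mul, Matrix.mul_one, Matrix.one_mul, hPM]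
  have hcs := trace_orthogonal_mul_proj_sq_le P (1 - M) hQ2 hQt hP hcQ
  have htrQ : trace (1 - M : Matrix n n ℚ) = (Fintype.card n : ℚ) - Fintype.card m := by
    rw [Matrix.trace_sub, Matrix.trace_one, htrM]
  have htrPQ : trace (P * (1 - M)) = trace P - trace R := by
    rw [Matrix.mul_sub, Matrix.trace_sub, Matrix.mul_one, htrPM]
  rw [htrQ, htrPQ] at hcs
  exact hcs

end intertwined

end Summit.Ventures.DiscreteObjects.Hadamard
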